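import Summits.QuantumFields.BalabanUV.T4Continuum.Spine.CovariantAveragingTower
import Summits.QuantumFields.BalabanUV.T4Continuum.Support.BalabanLineAverage
import Literature.MathematicalPhysics.QuantumFieldTheory.Balaban1983to89.B5G183RateUnitTower
import Literature.MathematicalPhysics.QuantumFieldTheory.Balaban1983to89.T4EtaRateMin

/-!
# T⁴ programme, spine node NE2 (U1a) — THE `U = 1` TOWER OF BAŁABAN's (1.18)-AVERAGED FREE COVARIANCE:
# `n_k^d·Q_k𝒢^{(L^{−k})}Q_kᴴ` on the unit lattice CONVERGES as `k → ∞`, rate `CQB·L^{−k}/(1 − L^{−1})`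
# (instance of `Spine/CovariantAveragingTower` with the one-step law of `Support/BalabanLineAverage`)

Eighth generation of the NE2 prover lineage P1 of the cell `pub-balaban`, file 3.

WHAT IS PROVED (every `d`, every torus of periods `M`, every `L ≥ 2`, `a > 0`; `U = 1`):
 * §1 the tower data: levels `n_k = L^k` (`B5G183RateUnitTower.lev`), index family `idx k = T_{L^{−k}} × {1..d}`,
   Bałaban's one-step averagings `QBlev k = QB n_k L` ([Balaban1984PropagatorsI] (1.11)/(1.18) between the lattices of
   spacings `L^{−k−1}` and `L^{−k}`, `Support/BalabanLineAverage.QB`) and the propagators `calGlev k = 𝒢^{(L^{−k})}`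
   ((1.83), `B5Prop11Plancherel.calG`);
 * §2 **`oneStepAveragedLaw_QB`**: the hypothesis shape `OneStepAveragedLaw` of the Spine file HOLDS for these data with
   `r = L^d`, `e_k = CQB(d,a)·L^{−k}` (from `opNorm_QB_calG_rate`); hence **`towerLimitRate_QB`** /
   **`unitCovB_tendsto`**: the unit-lattice images `unitCovB k := (L^d)^k · QBtow_k 𝒢^{(L^{−k})} QBtow_kᴴ` — the free
   covariance of the `k`-fold (1.18)-averaged field, [B5] (1.68)–(1.69) at `U = 1` seen on the unit lattice — CONVERGE,
   `‖unitCovB k − c_∞‖ ≤ CQB·L^{−k}/(1 − L^{−1})`, and **`opNorm_unitCovB_sub_le`** (two finite levels, the (4.38) shape);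
 * §3 consistency: King's componentwise tower of the lineage (`B5G183RateUnitTower.unitCov`, averaging (2.10)) is the
   instance `A k = Qavg n_k L` of the same Spine theorem (`oneStepAveragedLaw_Qavg`, `towerLimitRate_Qavg`);
 * §4 the LIAISON CURRENCY: entries are bounded by the operator norm (`norm_entry_le_opNorm`), so the real and imaginary
   parts of the entries of `unitCovB k` form an INSTANCE of the cell's species-agnostic shape `T4EtaRateMin.LocalRate`
   (**`localRate_unitCovB`**, constant `CQB`, rate `L^{−1}`, every `L ≥ 1`) — the same kind of hypothesis-free instance as
   `T4Cov2156Rate.cov2156_localRate` (lineage P2, species C^{(k)}(𝟙)), now for the species «(1.18)-averaged free covariance at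
   U = 1»; by `T4OperatorRateLiaison` §2 (`absRate_of_localRate`) such an instance converts mechanically into the consumer's
   `AbsOperatorRate`.  NOT NE3 content (no minimiser is read) and NOT NE2⁺ (no background).

WHY IT MATTERS FOR NE2 (record `t4/T4-EST-NE2-P1.md` §G7.0 (n)(o), §G8.0).  Generation 7 showed that King's soft
«effective Laplacian» form (2.14) transplanted to Bałaban's Landau-type `𝒢` with COMPONENTWISE averaging is NOT positive
(kit j077253), whereas Bałaban's own averaging (1.18) is the positive object of [B5] p. 30 (`B5QGQ171Unit`:
`‖n^d Q_k𝒢Q_kᴴ‖ = a⁻¹` exactly, `a − a²n^dQ_k𝒢Q_kᴴ ⪰ 0`).  The η-RATE / `k → ∞` limit of THAT object was open («needs a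
two-level law for `QvOp`»); files 2–3 of this generation close it at `U = 1`, by the composite of ONE-STEP (1.11)-averagings.
NOT CLAIMED here: (i) the entrywise identification of the composite `Atow QBlev k` with the single `L^k`-step operator
`B5Block118.QvOp (L^k) M` of (1.18) (the semigroup property of straight-contour block averages — true, routine, deferred to a
companion leaf; cf. `B5G183RateUnitTower.Qtow_apply` for King's `Q`); (ii) any identification of the limit `c_∞` with a
continuum object; (iii) position-space decay; (iv) anything at `U ≠ 1` — there the one-step law is the cell's open row
G-an2-4 (typed: `CovariantAveragingTower.OneStepAveragedLaw`).

HONEST FRAMING (T4-DAG p. 1).  `U = 1`, FIXED FINITE torus, linear (Gaussian) layer, operator norm; Bałaban prints no rate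
(every `[B5]` bound is η-uniform), King's (4.38) is the scalar template — statements and constants OURS ([folklore]).  No
conditional of the cell (`BetaPertH`, (B), (B^μ)) enters at `U = 1`.  NOT infinite volume, NOT a mass gap, NOT Clay, NOT
summit progress.  HONEST DEPENDENCY: continuum YM on T⁴ ⇐ BetaPertH ∧ nine spine estimates (0/9 proved); BetaPertH ⇐ (D1) ∧
(D4) ∧ CAP+tail; G-an2-4 gates asym, D1 and NE2/3/4.  ABSOLUTE RULE kept: inputs are kernel-proved tree modules only; no
`sorry`.
-/

noncomputable section

open scoped BigOperators ComplexConjugate Matrix Matrix.Norms.L2Operator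
open Filter Topology

namespace Summit.QuantumFields.BalabanUV.T4Continuum.BalabanAveragedTowerUnit

open Literature.MathematicalPhysics.QuantumFieldTheory.Balaban1983to89.B5Prop11Plancherel
open Literature.MathematicalPhysics.QuantumFieldTheory.Balaban1983to89.B5G183RateTorusW
open Literature.MathematicalPhysics.QuantumFieldTheory.Balaban1983to89.B5G183RateUnitTower (lev lev_neZero)
open Summit.QuantumFields.BalabanUV.T4Continuum.CovariantAveragingTower
open Summit.QuantumFields.BalabanUV.T4Continuum.BalabanLineAverage

variable {d : ℕ} (L : ℕ) [NeZero L] (M : Fin d → ℕ) [hM : ∀ μ, NeZero (M μ)]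

/-! ## §1 The tower data at `U = 1` -/

omit [NeZero L] in
/-- `n_{k+1} = L·n_k` (definitional). [folklore] -/
theorem lev_succ' (k : ℕ) : lev L (k + 1) = L * lev L k := rfl

/-- `1 ≤ n_k`. [folklore] -/
theorem one_le_lev' (k : ℕ) : 1 ≤ lev L k := Nat.pos_of_ne_zero (NeZero.ne _)

omit [NeZero L] in
/-- `n_k = L^k` in `ℝ`. [folklore] -/
theorem cast_lev' (k : ℕ) : ((lev L k : ℕ) : ℝ) = (L : ℝ) ^ k := by
  induction k with
  | zero => simp [lev]
  | succ k ih => rw [lev_succ', Nat.cast_mul, ih, pow_succ, mul_comm]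

/-- the level-`k` index set: sites of the lattice of spacing `L^{−k}` on the torus of periods `M`, times the vector
index. [folklore] -/
abbrev idx (k : ℕ) : Type := Tor (fine (lev L k) M) × Fin d

/-- BAŁABAN's ONE-STEP AVERAGINGS ALONG THE TOWER: `QBlev k` = the (1.11)/(1.18) line-block average from the lattice of
spacing `L^{−k−1}` to the lattice of spacing `L^{−k}`. [cite: Balaban1984PropagatorsI, (1.11) p.19, (1.18) p.20] -/
def QBlev (k : ℕ) : Matrix (idx L M k) (idx L M (k + 1)) ℂ := QB (lev L k) L M

variable (a : ℝ) (ha : 0 < a)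

/-- the propagators along the tower: `calGlev k = 𝒢^{(L^{−k})} = Δ_a^{−1}` at `U = 1` ((1.83)). [cite:
Balaban1984PropagatorsI, (1.83) p.31] -/
def calGlev (k : ℕ) : Matrix (idx L M k) (idx L M k) ℂ := calG (lev L k) (one_le_lev' L k) M a ha

/-- **the (1.18)-averaged unit-lattice free covariance after `k` steps**: `(L^d)^k · QBtow_k 𝒢^{(L^{−k})} QBtow_kᴴ`
(`QBtow_k = Atow QBlev k` the composite of the `k` one-step averagings) — the covariance of `Q_kA` for the Gaussian field
`A` with covariance `𝒢`, i.e. the quadratic form produced by [B5] (1.68)–(1.69) at `U = 1`, normalised to the unit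
lattice. [folklore] -/
def unitCovB (k : ℕ) : Matrix (idx L M 0) (idx L M 0) ℂ :=
  avgTow (QBlev L M) ((L : ℝ) ^ d) (calGlev L M a ha) k

/-! ## §2 The one-step law holds for Bałaban's averagings at `U = 1`; the tower converges -/

/-- `‖QBlev k‖² ≤ L^{−d}` at every level. [folklore] -/
theorem opNorm_QBlev_sq_le (k : ℕ) : ‖QBlev L M k‖ ^ 2 ≤ ((L : ℝ) ^ d)⁻¹ :=
  opNorm_QB_sq_le (lev L k) L M

/-- **`OneStepAveragedLaw` HOLDS for (Bałaban's averagings, the free propagators) at `U = 1`** with `r = L^d` and the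
geometric errors `e_k = CQB(d,a)·L^{−k}` — by `BalabanLineAverage.opNorm_QB_calG_rate` at `(N, R) = (L^k, L)`.
[cite: Balaban1984PropagatorsI, (1.18) p.20, Prop. 1.1 (1.89) p.33; King1986, Lemma 4.5 (4.38) p.674 (scalar template)]
[folklore] -/
theorem oneStepAveragedLaw_QB :
    OneStepAveragedLaw (QBlev L M) ((L : ℝ) ^ d) (calGlev L M a ha) (fun k => CQB d a * ((L : ℝ)⁻¹) ^ k) := by
  intro k
  have hL1 : 1 ≤ L := Nat.pos_of_ne_zero (NeZero.ne L)
  have h := opNorm_QB_calG_rate (lev L k) L M (one_le_lev' L k) hL1 (one_le_lev' L (k + 1)) a ha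
  have e1 : ((((L : ℝ) ^ d : ℝ) : ℂ))⁻¹ = ((L : ℂ) ^ d)⁻¹ := by push_cast; rfl
  have e2 : ((L : ℝ) ^ d)⁻¹ * (CQB d a * ((L : ℝ)⁻¹) ^ k) = ((L : ℝ) ^ d)⁻¹ * CQB d a / (lev L k : ℕ) := by
    rw [cast_lev', inv_pow]; ring
  rw [e1, e2]
  exact h

/-- **THE TOWER LIMIT WITH RATE for Bałaban's averaging at `U = 1`** (`L ≥ 2`): `TowerLimitRate` of the Spine file with
`C = CQB(d,a)`, `ρ = L^{−1}`. [cite: Balaban1984PropagatorsI, (1.18) p.20, Prop. 1.1 (1.89) p.33; King1986, Lemma 4.5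
(4.38) p.674 (scalar template)] [folklore] -/
theorem towerLimitRate_QB (hL : 2 ≤ L) :
    TowerLimitRate (QBlev L M) ((L : ℝ) ^ d) (calGlev L M a ha) (CQB d a) ((L : ℝ)⁻¹) := by
  have hL1 : (1 : ℝ) < L := by exact_mod_cast (lt_of_lt_of_le one_lt_two hL : 1 < L)
  have hr : (0 : ℝ) < (L : ℝ) ^ d := pow_pos (lt_trans zero_lt_one hL1) d
  exact towerLimitRate_of_oneStepAveragedLaw (QBlev L M) hr (opNorm_QBlev_sq_le L M) (calGlev L M a ha)
    (inv_lt_one_of_one_lt₀ hL1) (oneStepAveragedLaw_QB L M a ha)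

/-- **THE LIMIT OF THE (1.18)-AVERAGED UNIT-LATTICE FREE COVARIANCE EXISTS (`U = 1`, finite torus, `L ≥ 2`)**, with
`‖unitCovB k − c_∞‖ ≤ CQB(d,a)·L^{−k}/(1 − L^{−1})` for every `k`.  Statement and constant OURS; Bałaban prints no rate.
[cite: Balaban1984PropagatorsI, (1.18) p.20, (1.68)-(1.69) p.29, Prop. 1.1 (1.89) p.33; King1986, Lemma 4.5 (4.38) p.674
(scalar template)] [folklore] -/
theorem unitCovB_tendsto (hL : 2 ≤ L) :
    ∃ cinf : Matrix (idx L M 0) (idx L M 0) ℂ,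
      Tendsto (unitCovB L M a ha) atTop (𝓝 cinf) ∧
      ∀ k, ‖unitCovB L M a ha k - cinf‖ ≤ CQB d a * ((L : ℝ)⁻¹) ^ k / (1 - (L : ℝ)⁻¹) :=
  towerLimitRate_QB L M a ha hL

/-- one step of the tower: `‖unitCovB (k+1) − unitCovB k‖ ≤ CQB·L^{−k}` (`L ≥ 1`). [folklore] -/
theorem opNorm_unitCovB_succ_sub_le (k : ℕ) :
    ‖unitCovB L M a ha (k + 1) - unitCovB L M a ha k‖ ≤ CQB d a * ((L : ℝ)⁻¹) ^ k := by
  have hr : (0 : ℝ) < (L : ℝ) ^ d := pow_pos (by exact_mod_cast Nat.pos_of_ne_zero (NeZero.ne L)) d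
  exact opNorm_avgTow_succ_sub_le (QBlev L M) hr (opNorm_QBlev_sq_le L M) (calGlev L M a ha)
    (e := fun k => CQB d a * ((L : ℝ)⁻¹) ^ k) k (oneStepAveragedLaw_QB L M a ha k)

/-- **two finite levels** ((4.38) shape): `‖unitCovB k − unitCovB (k+n)‖ ≤ CQB·L^{−k}/(1 − L^{−1})` (`L ≥ 2`). [cite:
King1986, Lemma 4.5 (4.38) p.674 (scalar template)] [folklore] -/
theorem opNorm_unitCovB_sub_le (hL : 2 ≤ L) (k n : ℕ) :
    ‖unitCovB L M a ha k - unitCovB L M a ha (k + n)‖ ≤ CQB d a * ((L : ℝ)⁻¹) ^ k / (1 - (L : ℝ)⁻¹) := by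
  have hL1 : (1 : ℝ) < L := by exact_mod_cast (lt_of_lt_of_le one_lt_two hL : 1 < L)
  have hr : (0 : ℝ) < (L : ℝ) ^ d := pow_pos (lt_trans zero_lt_one hL1) d
  exact opNorm_avgTow_sub_avgTow_le (QBlev L M) hr (opNorm_QBlev_sq_le L M) (calGlev L M a ha)
    (inv_nonneg.mpr (Nat.cast_nonneg _)) (inv_lt_one_of_one_lt₀ hL1) (oneStepAveragedLaw_QB L M a ha) k n

/-! ## §3 Consistency: King's componentwise tower is the instance `A k = Qavg n_k L` of the same Spine theorem -/

/-- King's block averagings along the tower ((2.10), componentwise). [cite: King1986, (2.10) p.653] -/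
def Qlev (k : ℕ) : Matrix (idx L M k) (idx L M (k + 1)) ℂ := Qavg (lev L k) L M

/-- `‖Qlev k‖² ≤ L^{−d}`. [folklore] -/
theorem opNorm_Qlev_sq_le (k : ℕ) : ‖Qlev L M k‖ ^ 2 ≤ ((L : ℝ) ^ d)⁻¹ := by
  have hL : (0 : ℝ) < (L : ℝ) ^ d := pow_pos (by exact_mod_cast Nat.pos_of_ne_zero (NeZero.ne L)) d
  calc ‖Qlev L M k‖ ^ 2 ≤ ((Real.sqrt ((L : ℝ) ^ d))⁻¹) ^ 2 :=
        pow_le_pow_left₀ (norm_nonneg _) (opNorm_Qavg_le (lev L k) L M) 2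
    _ = ((L : ℝ) ^ d)⁻¹ := by rw [inv_pow, Real.sq_sqrt hL.le]

/-- `OneStepAveragedLaw` for KING's averagings at `U = 1` (`e_k = CQ(d,a)·L^{−k}`, the lineage's
`B5G183RateTorusW.opNorm_Qavg_calG_rate`). [cite: King1986, (2.10) p.653, Lemma 4.5 (4.38) p.674; Balaban1984PropagatorsI,
Prop. 1.1 (1.89) p.33] [folklore] -/
theorem oneStepAveragedLaw_Qavg :
    OneStepAveragedLaw (Qlev L M) ((L : ℝ) ^ d) (calGlev L M a ha) (fun k => CQ d a * ((L : ℝ)⁻¹) ^ k) := by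
  intro k
  have hL1 : 1 ≤ L := Nat.pos_of_ne_zero (NeZero.ne L)
  have h := opNorm_Qavg_calG_rate (lev L k) L M (one_le_lev' L k) hL1 (one_le_lev' L (k + 1)) a ha
  have e1 : ((((L : ℝ) ^ d : ℝ) : ℂ))⁻¹ = ((L : ℂ) ^ d)⁻¹ := by push_cast; rfl
  have e2 : ((L : ℝ) ^ d)⁻¹ * (CQ d a * ((L : ℝ)⁻¹) ^ k) = ((L : ℝ) ^ d)⁻¹ * CQ d a / (lev L k : ℕ) := by
    rw [cast_lev', inv_pow]; ring
  rw [e1, e2]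
  exact h

/-- King's tower limit with rate re-derived from the Spine theorem (same conclusion as
`B5G183RateUnitTower.unitCov_tendsto`, up to the bookkeeping `(L^d)^k = (L^k)^d`). [cite: King1986, Lemma 4.5 (4.38) p.674]
[folklore] -/
theorem towerLimitRate_Qavg (hL : 2 ≤ L) :
    TowerLimitRate (Qlev L M) ((L : ℝ) ^ d) (calGlev L M a ha) (CQ d a) ((L : ℝ)⁻¹) := by
  have hL1 : (1 : ℝ) < L := by exact_mod_cast (lt_of_lt_of_le one_lt_two hL : 1 < L)
  have hr : (0 : ℝ) < (L : ℝ) ^ d := pow_pos (lt_trans zero_lt_one hL1) d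
  exact towerLimitRate_of_oneStepAveragedLaw (Qlev L M) hr (opNorm_Qlev_sq_le L M) (calGlev L M a ha)
    (inv_lt_one_of_one_lt₀ hL1) (oneStepAveragedLaw_Qavg L M a ha)

/-! ## §4 The liaison currency: an INSTANCE of `T4EtaRateMin.LocalRate` for the (1.18)-averaged free covariance at `U = 1` -/

section Liaison

open Literature.MathematicalPhysics.QuantumFieldTheory.Balaban1983to89.T4EtaRateMin (Readings LocalRate)

omit [NeZero L] hM in
/-- entries are bounded by the `ℓ²`-operator norm: `‖A i j‖ ≤ ‖A‖` (test `A` on the basis vector `e_j` and read coordinate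
`i`). [folklore] -/
theorem norm_entry_le_opNorm {m n : Type*} [Fintype m] [DecidableEq m] [Fintype n] [DecidableEq n] (A : Matrix m n ℂ)
    (i : m) (j : n) : ‖A i j‖ ≤ ‖A‖ := by
  -- adapted from `Literature.Barriers.QuantumFields.UnitaryHaarSmallBall.norm_entry_le_l2_opNorm` (square `Fin N` case)
  set v : EuclideanSpace ℂ n := PiLp.single 2 j (1 : ℂ) with hv
  have hv1 : ‖v‖ = 1 := by rw [hv, PiLp.norm_single, norm_one]
  have h1 := Matrix.l2_opNorm_mulVec A v
  rw [hv1, mul_one] at h1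
  have h2 : ‖((EuclideanSpace.equiv m ℂ).symm (Matrix.mulVec A v.ofLp)) i‖ ≤
      ‖(EuclideanSpace.equiv m ℂ).symm (Matrix.mulVec A v.ofLp)‖ := PiLp.norm_apply_le _ i
  have h3 : ((EuclideanSpace.equiv m ℂ).symm (Matrix.mulVec A v.ofLp)) i = A i j := by
    have : v.ofLp = Pi.single j 1 := by
      rw [hv]; rfl
    simp [this]
  rw [h3] at h2
  exact h2.trans h1

/-- THE READINGS of the (1.18)-averaged unit-lattice free covariance at `U = 1`, as an instance of the cell's abstract
carrier `T4EtaRateMin.Readings`: datum type `Unit` (the linear theory at `U = 1` has one datum), sites = (pairs of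
unit-lattice indices) × `Bool` (real / imaginary part of the entry), `loc k _ ((i,j), b) = Re` or `Im` of `(unitCovB k)_{ij}`;
the scalar reading and the volume factor are unused (`0`). [folklore] -/
def covBReadings : Readings Unit ((idx L M 0 × idx L M 0) × Bool) where
  dom := Set.univ
  act := fun _ _ => 0
  loc := fun k _ x => if x.2 then ((unitCovB L M a ha k) x.1.1 x.1.2).re else ((unitCovB L M a ha k) x.1.1 x.1.2).im
  vol := 0
  vol_nonneg := le_rfl

/-- **THE SHAPE `LocalRate` HOLDS for the species «(1.18)-averaged free covariance at U = 1»**: consecutive levels' entries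
differ by at most `CQB(d,a)·L^{−k}` (real and imaginary parts), every `L ≥ 1`, every torus — an INSTANCE (a theorem), not a
hypothesis; NOT NE3 (no minimiser is read), NOT NE2⁺ (no background). [cite: King1986, Lemma 4.5 (4.38) p.674 (shape)]
[folklore] -/
theorem localRate_unitCovB : LocalRate (covBReadings L M a ha) (CQB d a) ((L : ℝ)⁻¹) := by
  intro k _ _ x
  have hstep := opNorm_unitCovB_succ_sub_le L M a ha k
  have hent : ‖(unitCovB L M a ha (k + 1) - unitCovB L M a ha k) x.1.1 x.1.2‖ ≤ CQB d a * ((L : ℝ)⁻¹) ^ k :=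
    (norm_entry_le_opNorm _ _ _).trans hstep
  rw [Matrix.sub_apply] at hent
  obtain ⟨⟨i, j⟩, b⟩ := x
  cases b with
  | true =>
    simp only [covBReadings, ↓reduceIte]
    rw [← Complex.sub_re]
    exact (Complex.abs_re_le_norm _).trans hent
  | false =>
    simp only [covBReadings, Bool.false_eq_true, ↓reduceIte]
    rw [← Complex.sub_im]
    exact (Complex.abs_im_le_norm _).trans hent

end Liaison

end Summit.QuantumFields.BalabanUV.T4Continuum.BalabanAveragedTowerUnit

end
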